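import Literature.Analysis.FluidPDE.Tao2016AveragedNS.SplitCascadeRescaledWindow
import Literature.Analysis.FluidPDE.Tao2016AveragedNS.SplitCascadeRescaledEnergy
import Literature.Analysis.FluidPDE.TaoCascadeCoarseSecondary
import HarnessLib

/-!
# The split Prop. 6.5, §6.7: coarse-scale secondary modes `b̃₋₁, c̃₋₁` ((6.168)–(6.171)) (port of `TaoCascadeCoarseSecondary`)

T. Tao, *Finite time blowup for an averaged three-dimensional Navier–Stokes equation*,
J. Amer. Math. Soc. 29 (2016), 601–674 = arXiv:1402.0290v3, §6.7 (6.168)–(6.171). HONEST FRAMING: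
statements about the SPLIT cascade model system; nothing here proves the split Prop. 6.5 and nothing
here concerns the true Navier–Stokes equations.

Split counterpart of `TaoCascadeCoarseSecondary.lean` (same names under `RescaledSplitHypotheses`):
hypotheses with `C₁/2`, window certificate `hw : AsymWindow ε₀ K ε C₁ n₀ W T ζ`, sub-windows
`[0, T'] ⊆ [0, T]`, and the energy bound of scale `-1` at least `K⁻¹⁰` (`(K^10)⁻¹ ≤ E₁`, true at every
call site: `2K⁻¹⁰`, `K⁻¹⁰(1+ε₀)^{2/10}`) so that the coarse mode equations have the tree's exact errors
(`eq_b_neg_one'`, `eq_c_neg_one'`); statements and proofs otherwise the tree's.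

## References

* T. Tao, J. Amer. Math. Soc. 29 (2016), 601–674 = arXiv:1402.0290v3, §6.7 (6.168)–(6.171).
  [`Tao2016AveragedNS`]
-/

noncomputable section

open Set MeasureTheory intervalIntegral Filter Topology

namespace Literature.Analysis.FluidPDE

namespace Tao2016AveragedNS

open TaoCascade Literature.Analysis.ODE

section CoarseSecondary

variable {γ ε₀ K ε C₁ C₂ C₃ : ℝ} {n₀ N : ℤ} {ηp : ℤ → ℝ} {βp : ℕ → ℝ} {τ : ℤ → ℝ}
  {Xr : Fin 4 → ℤ → ℝ → ℝ} {W : Fin 3 → ℤ → ℝ → ℝ} {Er : ℤ → ℝ → ℝ} {T ζ : ℝ}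

/-- **(6.168): `b₋₁` grows at most linearly.** On `[0, T']` with `Ẽ₋₁ ≤ E₁` there:
`b₋₁(t) ≤ b₋₁(0) + ((1+ε₀)^{-5/2}·2εE₁ + C₁(1+ε₀)^{-2-n₀/2}√E₁)·t` ("discarding the second term in
(6.135) as being non-positive"). [cite: Tao2016AveragedNS, §6.7 (6.168)] -/
theorem RescaledSplitHypotheses.coarse_b_upper
    (h : RescaledSplitHypotheses γ ε₀ K ε (C₁ / 2) C₂ C₃ n₀ N ηp βp τ Xr W Er)
    (hw : AsymWindow ε₀ K ε C₁ n₀ W T ζ) (hε : 0 < ε) (hε1 : ε ≤ 1) (hK1 : 1 ≤ K) (hC₁ : 0 ≤ C₁)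
    (hε₀ : 0 < ε₀) {T' E₁ : ℝ} (hτ0 : τ (n₀ - N) ≤ 0) (hT' : T' ≤ T) (hE₁K : (K ^ 10)⁻¹ ≤ E₁)
    (hreg : ∀ t ∈ Icc 0 T', Er (-1) t ≤ E₁) {t : ℝ} (ht : t ∈ Icc 0 T') :
    Xr 1 (-1) t ≤ Xr 1 (-1) 0 +
      ((1 + ε₀) ^ (-((5 : ℝ) / 2)) * (2 * ε * E₁) +
        C₁ * (1 + ε₀) ^ (-2 - (n₀ : ℝ) / 2) * Real.sqrt E₁) * t := by
  have hQ : 0 < (1 + ε₀) ^ (-((5 : ℝ) / 2)) := Real.rpow_pos_of_pos (by linarith) _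
  have hb := le_add_integral_of_deriv_right_le (h.continuousOn_X 1 (-1) hτ0)
    (fun s hs => h.hasDeriv_X 1 (-1) (hτ0.trans hs.1))
    (A := fun _ => (1 + ε₀) ^ (-((5 : ℝ) / 2)) * (2 * ε * E₁) +
        C₁ * (1 + ε₀) ^ (-2 - (n₀ : ℝ) / 2) * Real.sqrt E₁) continuousOn_const ?_ ht
  · have hI : ∫ s in (0 : ℝ)..t, (fun _ : ℝ => (1 + ε₀) ^ (-((5 : ℝ) / 2)) * (2 * ε * E₁) +
        C₁ * (1 + ε₀) ^ (-2 - (n₀ : ℝ) / 2) * Real.sqrt E₁) s =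
        ((1 + ε₀) ^ (-((5 : ℝ) / 2)) * (2 * ε * E₁) +
          C₁ * (1 + ε₀) ^ (-2 - (n₀ : ℝ) / 2) * Real.sqrt E₁) * t := by
      simp only [intervalIntegral.integral_const, smul_eq_mul]; ring
    rw [hI] at hb; exact hb
  · intro s hs
    have hs' : s ∈ Icc 0 T' := Ico_subset_Icc_self hs
    have hs0 : τ (n₀ - N) ≤ s := hτ0.trans hs.1
    have he := (abs_le.mp (h.eq_b_neg_one' hw hτ0 hε hε1 hK1 hC₁ hε₀ ⟨hs'.1, hs'.2.trans hT'⟩ hE₁K (hreg s hs'))).2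
    have haa := h.sq_le_two_mul_energy 0 (-1) hs0
    have hE := hreg s hs'
    have hneg : 0 ≤ (1 + ε₀) ^ (-((5 : ℝ) / 2)) * (ε⁻¹ * K ^ 10 * Xr 2 (-1) s ^ 2) := by positivity
    have hpos : (1 + ε₀) ^ (-((5 : ℝ) / 2)) * (ε * Xr 0 (-1) s ^ 2) ≤
        (1 + ε₀) ^ (-((5 : ℝ) / 2)) * (2 * ε * E₁) := by
      apply mul_le_mul_of_nonneg_left _ hQ.le
      nlinarith
    have hsplit : (1 + ε₀) ^ (-((5 : ℝ) / 2)) * (ε * Xr 0 (-1) s ^ 2 - ε⁻¹ * K ^ 10 * Xr 2 (-1) s ^ 2) =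
        (1 + ε₀) ^ (-((5 : ℝ) / 2)) * (ε * Xr 0 (-1) s ^ 2) -
          (1 + ε₀) ^ (-((5 : ℝ) / 2)) * (ε⁻¹ * K ^ 10 * Xr 2 (-1) s ^ 2) := by ring
    rw [hsplit] at he
    show derivWithin (Xr 1 (-1)) (Ici (τ (n₀ - N))) s ≤ _
    linarith

/-- **(6.169): `|c₋₁| ≲ exp(O(K^{10}))ε²`.** On `[0, T']` with `Ẽ₋₁ ≤ E₁` (`E₁ ≥ 0`) and an upper
bound `b₋₁ ≤ b̄` with `b̄ ≥ 0` there, `W = c₋₁²` obeys `W' ≤ 2α√W + 2κW` with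
`α = (1+ε₀)^{-5/2}·2ε²e^{-K^{10}}E₁ + C₁(1+ε₀)^{-2-n₀/2}√E₁` and `κ = (1+ε₀)^{-5/2}ε⁻¹K^{10}b̄`, hence
`|c₋₁(t)| ≤ e^{κt}(|c₋₁(0)| + αt)` ("by Gronwall's inequality and (6.63)").
[cite: Tao2016AveragedNS, §6.7 (6.169)] -/
theorem RescaledSplitHypotheses.coarse_c_abs_le
    (h : RescaledSplitHypotheses γ ε₀ K ε (C₁ / 2) C₂ C₃ n₀ N ηp βp τ Xr W Er)
    (hw : AsymWindow ε₀ K ε C₁ n₀ W T ζ) (hε : 0 < ε) (hε1 : ε ≤ 1) (hK1 : 1 ≤ K) (hC₁ : 0 ≤ C₁)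
    (hε₀ : 0 < ε₀) {T' E₁ bbar : ℝ} (hτ0 : τ (n₀ - N) ≤ 0) (hT' : T' ≤ T) (hE₁K : (K ^ 10)⁻¹ ≤ E₁) (hE1 : 0 ≤ E₁) (hbbar : 0 ≤ bbar)
    (hreg : ∀ t ∈ Icc 0 T', Er (-1) t ≤ E₁) (hb : ∀ t ∈ Icc 0 T', Xr 1 (-1) t ≤ bbar)
    {t : ℝ} (ht : t ∈ Icc 0 T') :
    |Xr 2 (-1) t| ≤ Real.exp ((1 + ε₀) ^ (-((5 : ℝ) / 2)) * (ε⁻¹ * K ^ 10) * bbar * (t - 0)) *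
      (|Xr 2 (-1) 0| + ∫ s in (0 : ℝ)..t,
        (fun _ : ℝ => (1 + ε₀) ^ (-((5 : ℝ) / 2)) * (2 * ε ^ 2 * Real.exp (-K ^ 10) * E₁) +
          C₁ * (1 + ε₀) ^ (-2 - (n₀ : ℝ) / 2) * Real.sqrt E₁) s) := by
  have hq0 : (0 : ℝ) < 1 + ε₀ := by linarith
  have hQ : 0 < (1 + ε₀) ^ (-((5 : ℝ) / 2)) := Real.rpow_pos_of_pos hq0 _
  have hηm : 0 ≤ C₁ * (1 + ε₀) ^ (-2 - (n₀ : ℝ) / 2) * Real.sqrt E₁ :=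
    mul_nonneg (mul_nonneg hC₁ (Real.rpow_nonneg hq0.le _)) (Real.sqrt_nonneg _)
  have hWc : ContinuousOn (fun s => Xr 2 (-1) s ^ 2) (Icc 0 T') := (h.continuousOn_X 2 (-1) hτ0).pow 2
  have hWd : ∀ s ∈ Ico 0 T', HasDerivWithinAt (fun s => Xr 2 (-1) s ^ 2)
      (2 * Xr 2 (-1) s * derivWithin (Xr 2 (-1)) (Ici (τ (n₀ - N))) s) (Ici s) s := by
    intro s hs
    have := (h.hasDeriv_X 2 (-1) (hτ0.trans hs.1)).fun_pow 2
    exact this.congr_deriv (by push_cast; ring)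
  have key := sqrt_le_of_deriv_right_le hWc hWd (fun s _ => sq_nonneg _)
    (α := fun _ => (1 + ε₀) ^ (-((5 : ℝ) / 2)) * (2 * ε ^ 2 * Real.exp (-K ^ 10) * E₁) +
      C₁ * (1 + ε₀) ^ (-2 - (n₀ : ℝ) / 2) * Real.sqrt E₁)
    (κ := (1 + ε₀) ^ (-((5 : ℝ) / 2)) * (ε⁻¹ * K ^ 10) * bbar)
    continuousOn_const (fun s _ => by positivity) (by positivity) ?_ ht
  · simpa only [Real.sqrt_sq_eq_abs] using key
  · intro s hs
    have hs' : s ∈ Icc 0 T' := Ico_subset_Icc_self hs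
    have hs0 : τ (n₀ - N) ≤ s := hτ0.trans hs.1
    have he := h.eq_c_neg_one' hw hτ0 hε hε1 hK1 hC₁ hε₀ ⟨hs'.1, hs'.2.trans hT'⟩ hE₁K (hreg s hs')
    have haa := h.sq_le_two_mul_energy 0 (-1) hs0
    have hE := hreg s hs'
    have hbs := hb s hs'
    rw [Real.sqrt_sq_eq_abs]
    set Q := (1 + ε₀) ^ (-((5 : ℝ) / 2)) with hQdef
    set c := Xr 2 (-1) s with hcdef
    set e₃ := derivWithin (Xr 2 (-1)) (Ici (τ (n₀ - N))) s -
      Q * (ε ^ 2 * Real.exp (-K ^ 10) * Xr 0 (-1) s ^ 2 + ε⁻¹ * K ^ 10 * Xr 1 (-1) s * c) with he₃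
    have hkey : 2 * c * derivWithin (Xr 2 (-1)) (Ici (τ (n₀ - N))) s =
        2 * (c * (Q * (ε ^ 2 * Real.exp (-K ^ 10) * Xr 0 (-1) s ^ 2) + e₃)) +
          2 * (Q * (ε⁻¹ * K ^ 10) * Xr 1 (-1) s) * c ^ 2 := by
      simp only [he₃]; ring
    rw [hkey]
    -- the source-plus-error factor
    have hsrc : |Q * (ε ^ 2 * Real.exp (-K ^ 10) * Xr 0 (-1) s ^ 2) + e₃| ≤
        Q * (2 * ε ^ 2 * Real.exp (-K ^ 10) * E₁) +
          C₁ * (1 + ε₀) ^ (-2 - (n₀ : ℝ) / 2) * Real.sqrt E₁ := by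
      refine (abs_add_le _ _).trans (add_le_add ?_ he)
      rw [abs_of_nonneg (by positivity)]
      apply mul_le_mul_of_nonneg_left _ hQ.le
      have : 0 ≤ ε ^ 2 * Real.exp (-K ^ 10) := by positivity
      nlinarith
    have t1 : c * (Q * (ε ^ 2 * Real.exp (-K ^ 10) * Xr 0 (-1) s ^ 2) + e₃) ≤
        (Q * (2 * ε ^ 2 * Real.exp (-K ^ 10) * E₁) +
          C₁ * (1 + ε₀) ^ (-2 - (n₀ : ℝ) / 2) * Real.sqrt E₁) * |c| := by
      calc c * (Q * (ε ^ 2 * Real.exp (-K ^ 10) * Xr 0 (-1) s ^ 2) + e₃)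
          ≤ |c * (Q * (ε ^ 2 * Real.exp (-K ^ 10) * Xr 0 (-1) s ^ 2) + e₃)| := le_abs_self _
        _ = |c| * |Q * (ε ^ 2 * Real.exp (-K ^ 10) * Xr 0 (-1) s ^ 2) + e₃| := abs_mul _ _
        _ ≤ |c| * (Q * (2 * ε ^ 2 * Real.exp (-K ^ 10) * E₁) +
              C₁ * (1 + ε₀) ^ (-2 - (n₀ : ℝ) / 2) * Real.sqrt E₁) :=
            mul_le_mul_of_nonneg_left hsrc (abs_nonneg _)
        _ = _ := mul_comm _ _
    have t2 : (Q * (ε⁻¹ * K ^ 10) * Xr 1 (-1) s) * c ^ 2 ≤ (Q * (ε⁻¹ * K ^ 10) * bbar) * c ^ 2 := by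
      apply mul_le_mul_of_nonneg_right _ (sq_nonneg _)
      exact mul_le_mul_of_nonneg_left hbs (by positivity)
    linarith

/-- **`b₋₁` is bounded below** ((6.170): "`∂ₜb₋₁ ≥ -O(exp(O(K^{10})))ε³` and hence by (6.60)
`b₋₁(t) ≥ 10⁻⁶ε`"). On `[0, T']` with `Ẽ₋₁ ≤ E₁` and `|c₋₁| ≤ c̄` there:
`b₋₁(t) ≥ b₋₁(0) - ((1+ε₀)^{-5/2}ε⁻¹K^{10}c̄² + C₁(1+ε₀)^{-2-n₀/2}√E₁)·t`.
[cite: Tao2016AveragedNS, §6.7 (6.170)] -/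
theorem RescaledSplitHypotheses.coarse_b_lower
    (h : RescaledSplitHypotheses γ ε₀ K ε (C₁ / 2) C₂ C₃ n₀ N ηp βp τ Xr W Er)
    (hw : AsymWindow ε₀ K ε C₁ n₀ W T ζ) (hε : 0 < ε) (hε1 : ε ≤ 1) (hK1 : 1 ≤ K) (hC₁ : 0 ≤ C₁)
    (hε₀ : 0 < ε₀) {T' E₁ cbar : ℝ} (hτ0 : τ (n₀ - N) ≤ 0) (hT' : T' ≤ T) (hE₁K : (K ^ 10)⁻¹ ≤ E₁)
    (hreg : ∀ t ∈ Icc 0 T', Er (-1) t ≤ E₁) (hc : ∀ t ∈ Icc 0 T', |Xr 2 (-1) t| ≤ cbar)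
    {t : ℝ} (ht : t ∈ Icc 0 T') :
    Xr 1 (-1) 0 - ((1 + ε₀) ^ (-((5 : ℝ) / 2)) * (ε⁻¹ * K ^ 10) * cbar ^ 2 +
      C₁ * (1 + ε₀) ^ (-2 - (n₀ : ℝ) / 2) * Real.sqrt E₁) * t ≤ Xr 1 (-1) t := by
  have hQ : 0 < (1 + ε₀) ^ (-((5 : ℝ) / 2)) := Real.rpow_pos_of_pos (by linarith) _
  have hb := add_integral_le_of_le_deriv_right (h.continuousOn_X 1 (-1) hτ0)
    (fun s hs => h.hasDeriv_X 1 (-1) (hτ0.trans hs.1))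
    (A := fun _ => -((1 + ε₀) ^ (-((5 : ℝ) / 2)) * (ε⁻¹ * K ^ 10) * cbar ^ 2 +
      C₁ * (1 + ε₀) ^ (-2 - (n₀ : ℝ) / 2) * Real.sqrt E₁)) continuousOn_const ?_ ht
  · have hI : ∫ s in (0 : ℝ)..t, (fun _ : ℝ => -((1 + ε₀) ^ (-((5 : ℝ) / 2)) *
        (ε⁻¹ * K ^ 10) * cbar ^ 2 + C₁ * (1 + ε₀) ^ (-2 - (n₀ : ℝ) / 2) * Real.sqrt E₁)) s =
        -(((1 + ε₀) ^ (-((5 : ℝ) / 2)) * (ε⁻¹ * K ^ 10) * cbar ^ 2 +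
          C₁ * (1 + ε₀) ^ (-2 - (n₀ : ℝ) / 2) * Real.sqrt E₁) * t) := by
      simp only [intervalIntegral.integral_const, smul_eq_mul]; ring
    rw [hI] at hb; linarith
  · intro s hs
    have hs' : s ∈ Icc 0 T' := Ico_subset_Icc_self hs
    have hs0 : τ (n₀ - N) ≤ s := hτ0.trans hs.1
    have he := (abs_le.mp (h.eq_b_neg_one' hw hτ0 hε hε1 hK1 hC₁ hε₀ ⟨hs'.1, hs'.2.trans hT'⟩ hE₁K (hreg s hs'))).1
    have hcs := hc s hs'
    have hc0 : 0 ≤ cbar := (abs_nonneg _).trans hcs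
    have hsq : Xr 2 (-1) s ^ 2 ≤ cbar ^ 2 := by
      rw [← sq_abs]; exact pow_le_pow_left₀ (abs_nonneg _) hcs 2
    have hpos : 0 ≤ (1 + ε₀) ^ (-((5 : ℝ) / 2)) * (ε * Xr 0 (-1) s ^ 2) := by positivity
    have hneg : (1 + ε₀) ^ (-((5 : ℝ) / 2)) * (ε⁻¹ * K ^ 10 * Xr 2 (-1) s ^ 2) ≤
        (1 + ε₀) ^ (-((5 : ℝ) / 2)) * (ε⁻¹ * K ^ 10) * cbar ^ 2 := by
      rw [mul_assoc ((1 + ε₀) ^ (-((5 : ℝ) / 2)))]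
      apply mul_le_mul_of_nonneg_left _ hQ.le
      exact mul_le_mul_of_nonneg_left hsq (by positivity)
    have hsplit : (1 + ε₀) ^ (-((5 : ℝ) / 2)) * (ε * Xr 0 (-1) s ^ 2 - ε⁻¹ * K ^ 10 * Xr 2 (-1) s ^ 2) =
        (1 + ε₀) ^ (-((5 : ℝ) / 2)) * (ε * Xr 0 (-1) s ^ 2) -
          (1 + ε₀) ^ (-((5 : ℝ) / 2)) * (ε⁻¹ * K ^ 10 * Xr 2 (-1) s ^ 2) := by ring
    rw [hsplit] at he
    show _ ≤ derivWithin (Xr 1 (-1)) (Ici (τ (n₀ - N))) s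
    linarith

/-- **(6.171): exponential growth of `c₋₁` from below.** On `[0, T']` with `Ẽ₋₁ ≤ E₁` and a lower
bound `b₋₁ ≥ b̲ ≥ 0` there ("Inserting this into (6.136), we see that
`∂ₜc₋₁ ≥ 10⁻⁶K^{10}c₋₁ - O((1+ε₀)^{-n₀/2})`"): with `β₀ = (1+ε₀)^{-5/2}ε⁻¹K^{10}b̲` and
`η = C₁(1+ε₀)^{-2-n₀/2}√E₁`, `c₋₁(t) ≥ e^{β₀t}(c₋₁(0) - ηt)` provided `c₋₁(0) ≥ ηt`.
[cite: Tao2016AveragedNS, §6.7 (6.171)] -/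
theorem RescaledSplitHypotheses.coarse_c_lower
    (h : RescaledSplitHypotheses γ ε₀ K ε (C₁ / 2) C₂ C₃ n₀ N ηp βp τ Xr W Er)
    (hw : AsymWindow ε₀ K ε C₁ n₀ W T ζ) (hε : 0 < ε) (hε1 : ε ≤ 1) (hK1 : 1 ≤ K) (hC₁ : 0 ≤ C₁)
    (hε₀ : 0 < ε₀) {T' E₁ blo : ℝ} (hτ0 : τ (n₀ - N) ≤ 0) (hT' : T' ≤ T) (hE₁K : (K ^ 10)⁻¹ ≤ E₁) (hblo : 0 ≤ blo)
    (hreg : ∀ t ∈ Icc 0 T', Er (-1) t ≤ E₁) (hb : ∀ t ∈ Icc 0 T', blo ≤ Xr 1 (-1) t)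
    {t : ℝ} (ht : t ∈ Icc 0 T')
    (hc0 : C₁ * (1 + ε₀) ^ (-2 - (n₀ : ℝ) / 2) * Real.sqrt E₁ * (t - 0) ≤ Xr 2 (-1) 0) :
    Real.exp ((1 + ε₀) ^ (-((5 : ℝ) / 2)) * (ε⁻¹ * K ^ 10) * blo * (t - 0)) *
        (Xr 2 (-1) 0 - C₁ * (1 + ε₀) ^ (-2 - (n₀ : ℝ) / 2) * Real.sqrt E₁ * (t - 0)) ≤
      Xr 2 (-1) t := by
  have hq0 : (0 : ℝ) < 1 + ε₀ := by linarith
  have hQ : 0 < (1 + ε₀) ^ (-((5 : ℝ) / 2)) := Real.rpow_pos_of_pos hq0 _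
  have hηm : 0 ≤ C₁ * (1 + ε₀) ^ (-2 - (n₀ : ℝ) / 2) * Real.sqrt E₁ :=
    mul_nonneg (mul_nonneg hC₁ (Real.rpow_nonneg hq0.le _)) (Real.sqrt_nonneg _)
  have hβc : ContinuousOn (fun s => (1 + ε₀) ^ (-((5 : ℝ) / 2)) * (ε⁻¹ * K ^ 10) * Xr 1 (-1) s)
      (Icc 0 T') := continuousOn_const.mul (h.continuousOn_X 1 (-1) hτ0)
  refine exp_growth_lower (h.continuousOn_X 2 (-1) hτ0)
    (fun s hs => h.hasDeriv_X 2 (-1) (hτ0.trans hs.1)) hβc (by positivity)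
    (fun s hs => mul_le_mul_of_nonneg_left (hb s hs) (by positivity)) hηm ?_ ht hc0
  intro s hs
  have hs' : s ∈ Icc 0 T' := Ico_subset_Icc_self hs
  have hs0 : τ (n₀ - N) ≤ s := hτ0.trans hs.1
  have he := (abs_le.mp (h.eq_c_neg_one' hw hτ0 hε hε1 hK1 hC₁ hε₀ ⟨hs'.1, hs'.2.trans hT'⟩ hE₁K (hreg s hs'))).1
  have hsrc : 0 ≤ (1 + ε₀) ^ (-((5 : ℝ) / 2)) * (ε ^ 2 * Real.exp (-K ^ 10) * Xr 0 (-1) s ^ 2) := by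
    positivity
  have hsplit : (1 + ε₀) ^ (-((5 : ℝ) / 2)) *
      (ε ^ 2 * Real.exp (-K ^ 10) * Xr 0 (-1) s ^ 2 + ε⁻¹ * K ^ 10 * Xr 1 (-1) s * Xr 2 (-1) s) =
      (1 + ε₀) ^ (-((5 : ℝ) / 2)) * (ε ^ 2 * Real.exp (-K ^ 10) * Xr 0 (-1) s ^ 2) +
        (1 + ε₀) ^ (-((5 : ℝ) / 2)) * (ε⁻¹ * K ^ 10) * Xr 1 (-1) s * Xr 2 (-1) s := by ring
  rw [hsplit] at he
  show _ ≤ derivWithin (Xr 2 (-1)) (Ici (τ (n₀ - N))) s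
  linarith

/-- **(6.173): `∂ₜc₋₁ = O(K^{10}c₋₁)`, pointwise form.** At a time `t ≥ τ_{n₀-N}` with
`Ẽ₋₁(t) ≤ E₁`: `|∂ₜc₋₁| ≤ (1+ε₀)^{-5/2}(2ε²e^{-K^{10}}E₁ + ε⁻¹K^{10}|b₋₁||c₋₁|) + C₁(1+ε₀)^{-2-n₀/2}√E₁`.
[cite: Tao2016AveragedNS, §6.7 (6.173)] -/
theorem RescaledSplitHypotheses.coarse_c_deriv_abs_le
    (h : RescaledSplitHypotheses γ ε₀ K ε (C₁ / 2) C₂ C₃ n₀ N ηp βp τ Xr W Er)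
    (hw : AsymWindow ε₀ K ε C₁ n₀ W T ζ) (hε : 0 < ε) (hε1 : ε ≤ 1) (hK1 : 1 ≤ K) (hC₁ : 0 ≤ C₁)
    (hε₀ : 0 < ε₀) {t E₁ : ℝ} (hτ0 : τ (n₀ - N) ≤ 0) (ht : t ∈ Icc 0 T) (hE₁K : (K ^ 10)⁻¹ ≤ E₁)
    (hE : Er (-1) t ≤ E₁) :
    |derivWithin (Xr 2 (-1)) (Ici (τ (n₀ - N))) t| ≤
      (1 + ε₀) ^ (-((5 : ℝ) / 2)) *
          (2 * ε ^ 2 * Real.exp (-K ^ 10) * E₁ + ε⁻¹ * K ^ 10 * (|Xr 1 (-1) t| * |Xr 2 (-1) t|)) +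
        C₁ * (1 + ε₀) ^ (-2 - (n₀ : ℝ) / 2) * Real.sqrt E₁ := by
  have hQ : 0 < (1 + ε₀) ^ (-((5 : ℝ) / 2)) := Real.rpow_pos_of_pos (by linarith) _
  have he := h.eq_c_neg_one' hw hτ0 hε hε1 hK1 hC₁ hε₀ ht hE₁K hE
  have haa := h.sq_le_two_mul_energy 0 (-1) (hτ0.trans ht.1)
  have hmain : |(1 + ε₀) ^ (-((5 : ℝ) / 2)) *
      (ε ^ 2 * Real.exp (-K ^ 10) * Xr 0 (-1) t ^ 2 + ε⁻¹ * K ^ 10 * Xr 1 (-1) t * Xr 2 (-1) t)| ≤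
      (1 + ε₀) ^ (-((5 : ℝ) / 2)) *
        (2 * ε ^ 2 * Real.exp (-K ^ 10) * E₁ + ε⁻¹ * K ^ 10 * (|Xr 1 (-1) t| * |Xr 2 (-1) t|)) := by
    rw [abs_mul, abs_of_pos hQ]
    apply mul_le_mul_of_nonneg_left _ hQ.le
    refine (abs_add_le _ _).trans (add_le_add ?_ ?_)
    · rw [abs_of_nonneg (by positivity)]
      have : 0 ≤ ε ^ 2 * Real.exp (-K ^ 10) := by positivity
      nlinarith
    · rw [abs_mul, abs_mul, abs_of_nonneg (by positivity : (0 : ℝ) ≤ ε⁻¹ * K ^ 10)]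
      linarith
  have := abs_sub_abs_le_abs_sub (derivWithin (Xr 2 (-1)) (Ici (τ (n₀ - N))) t)
    ((1 + ε₀) ^ (-((5 : ℝ) / 2)) *
      (ε ^ 2 * Real.exp (-K ^ 10) * Xr 0 (-1) t ^ 2 + ε⁻¹ * K ^ 10 * Xr 1 (-1) t * Xr 2 (-1) t))
  linarith

end CoarseSecondary

end Tao2016AveragedNS

end Literature.Analysis.FluidPDE
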